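import Summits.QuantumFields.YangMills.Theorems.BalabanUVNodesN22W1CouplingRadiiPhaseTower
import Literature.MathematicalPhysics.QuantumFieldTheory.Balaban1983to89.T4ActivityRecursionWitness

/-!
# BalabanUVNodes ∕ node N22 = NE9 — THE W1 FUNCTIONAL OF THE PHASE TOWER READS THE COUPLINGS: `E^{(k+1)}` at a single cube is the Kotecký–Preiss
# logarithm `log(1 + H(□))`, so at the phase tower the SUBJECT of `NE9` — `W1.functionalOn S p emb` — is NOT history-constant (functional-level A6)

Cell `pub-ymgap`, HUMAN RULING D-0062 (Track A) ∕ D-0149, WIDTH SEAT `pub-ymgap-dag-n22-w1` (harness re-seat g3) on node n22 = NE9; `--kind proof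
--supports stmt-QuantumFields-20544 --as helper` (K3⁷ `SpineGivenEndpointR13SepCoPH`), COUNT-NEUTRAL.  THEOREMS ONLY (0 `def`, 0 `sorry`, standard axioms); imports
this seat's `…N22W1CouplingRadiiPhaseTower` (p611030) and the tree's `…Balaban1983to89.T4ActivityRecursionWitness` §1 (the one-polymer bookkeeping of the abstract
polymer gas, BY NAME: `truncatedWeight_singleton`, `polymerLogZ_singleton` — `Φ^T({γ}) = log Z({γ}) = Log(1 + w γ)` on the slit plane).

WHY.  `…PhaseTower` ∕ `…PhaseTowerVertex` certify non-degeneracy at the ACTIVITY level (`H` reads every coupling); node N22's statement `NE9 (W1.functionalOn S p emb) …`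
is about the FUNCTIONAL `(g, U, ⟨j, X⟩) ↦ Re E^{(j)}(X; g₀…g_{j−1}; emb U)`, (2.13)'s cluster sum of the activities.  THIS MODULE closes that gap: for ANY cluster step `S`,
at a SINGLE-CUBE localization domain `□ = cubeDom x ∈ 𝐃_{k+1}` the only family of polymers covering `□` is `{□}`, so (2.13) reduces to its
`n = 1` term in Kotecký–Preiss form: `E^{(k+1)}(□) = Φ^T({□}; H) = log Ξ_{{□}}(H)` (`E_cubeDom_eq_polymerLogZ`), the PRINCIPAL logarithm `Log(1 + H(□))` when
`‖H(□)‖ < 1` (`E_cubeDom_eq_log`), with real part `log ‖1 + H(□)‖` (`re_E_cubeDom`, `functionalOn_cubeDom`).  At the phase tower `H(□; g) = A e^{−2}·e^{iθ_k(g)}` (`d_{k+1}(□) = 0`),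
`‖1 + A e^{−2} e^{iθ}‖² = 1 + 2A e^{−2} cos θ + A² e^{−4}` (`normSq_one_add_real_mul_cexp`), and `cos` separates two histories of the window already at creation level 1:
★ `exists_functionalOn_ne_phaseTower` — for `0 < A e^{−2} < 1`, `γ > 0`, any pairing, background and reading, THERE ARE `g, g′ ∈ ]0, γ]^ℕ` with
`functionalOn S p emb g U ⟨1, □⟩ ≠ functionalOn S p emb g′ U ⟨1, □⟩`.  Hence g2's ★ `NE9 ∧ FadingMemory` at the phase tower (`…PhaseTower.ne9_and_fadingMemory_phaseTower`)
bounds a NON-TRIVIAL difference: its subject reads the couplings.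

WHAT (all [folklore]: (2.13)'s `n = 1` term + elementary trigonometry).  §1 (ANY `ClusterStep`): `E_cubeDom_eq_polymerLogZ`, `E_cubeDom_eq_log`,
`re_E_cubeDom`, `functionalOn_cubeDom` (the W1 functional at an atom of creation level `k+1`).  §2 (phase tower): `normSq_one_add_real_mul_cexp`,
`functionalOn_cubeDom_phaseTower` (`= log ‖1 + A e^{−2} e^{iθ_k(g|_k)}‖`), ★ `exists_functionalOn_ne_phaseTower`.

HONEST FRAMING.  §1 is bookkeeping about node00-def-W1's (2.13) AS DEFINED (`W1.ClusterStep.E` = `B13Resummation.locE`), valid for every tower; §2 is about the MODEL tower of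
`…PhaseTower`, NOT NODE 00's objects; a model-level inhabitant books NO discharge.  Count-neutral A6 helper; N22 NOT discharged (typed 28∕28 · discharged 5∕27 UNCHANGED —
the chair's single count line is the only count); K3⁷ OPEN, NOT claimed; NE9 ∕ `FadingMemory` NOT IN PRINT for d = 4; one finite four-torus programme at fixed ε — R4 closes
the CONDITIONAL rung `BalabanLadder.UV` only; NOT infinite volume ∕ OS on ℝ⁴ ∕ mass gap ∕ Clay.
References (TYPES only): [II] = [Balaban1988RG2Cluster] CMP **116** (1988) (2.13) p. 14 (the `n = 1` term `H(X)`); [KoteckyPreiss1986] (2)–(3).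
-/

noncomputable section

namespace YMDAG.N22.W1.CouplingRadii.PhaseTower

open Set Metric
open scoped BigOperators
open Literature.Probability.LatticeModels (polymerLogZ truncatedWeight)
open Literature.MathematicalPhysics.QuantumFieldTheory.Balaban1983to89.T4ActivityRecursionWitness (truncatedWeight_singleton polymerLogZ_singleton)
open Literature.MathematicalPhysics.QuantumFieldTheory.Balaban1983to89
open Literature.MathematicalPhysics.QuantumFieldTheory.Balaban1983to89.T4Continuum (T4Family)
open Literature.MathematicalPhysics.QuantumFieldTheory.Balaban1983to89.T4OutputRate
open Literature.MathematicalPhysics.QuantumFieldTheory.Balaban1983to89.TreeLengthTorus (TPt)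
open Literature.MathematicalPhysics.QuantumFieldTheory.Balaban1983to89.TreeLengthTorusGeometry (TTouch)
open Literature.MathematicalPhysics.QuantumFieldTheory.Balaban1983to89.B13FamilySum (coveringFamilies mem_coveringFamilies)
open Literature.MathematicalPhysics.QuantumFieldTheory.Balaban1983to89.Node00
open Literature.MathematicalPhysics.QuantumFieldTheory.Balaban1983to89.Node00.Sect2 (domSys domCount CPair cubeDom dj_cubeDom)
open Literature.MathematicalPhysics.QuantumFieldTheory.Balaban1983to89.Node00.W1

/-! ## §1 `E^{(k+1)}` at a single cube (any cluster step): the `n = 1` term of (2.13) -/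

section Atom
variable {P : Params} {𝔸 : Type*} {M : ℕ}

open Classical in
/-- **`E^{(k+1)}(□) = log Ξ_{{□}}(H)`**: at a single cube the ONLY family of polymers covering `□` is `{□}` (every member of a covering family has footprint
`⊆ {x}`, non-empty, hence `= {x}`), so (2.13) of record reduces to its `n = 1` term in Kotecký–Preiss form — the truncated functional of the one-polymer cluster `{□}`,
i.e. the KP logarithm of the ONE-POLYMER volume `{□}` with activity `H(·; g; φ)` (`Φ^T({□}) = log Ξ_{{□}} = H(□) − ½H(□)² + …`).
[cite: Balaban1988RG2Cluster, (2.13) p.14; KoteckyPreiss1986, (2)-(3)] -/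
theorem E_cubeDom_eq_polymerLogZ {k : ℕ} (S : ClusterStep P 𝔸 M k) (g : Fin (k + 1) → ℝ) (φ : CPair P 𝔸) (x : TPt P.d (domCount P M (k + 1))) :
    S.E g φ (cubeDom P M (k + 1) x) =
      polymerLogZ (TTouch (d := P.d) (N := domCount P M (k + 1))) (fun Z => S.H g φ Z) {cubeDom P M (k + 1) x} := by
  rw [ClusterStep.E_eq_locE, B13Resummation.locE]
  refine (Finset.sum_eq_single_of_mem ({cubeDom P M (k + 1) x} : Finset (domSys P M (k + 1)).Dom) ?_ ?_).trans
    (truncatedWeight_singleton _ _)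
  · exact mem_coveringFamilies.mpr ⟨Finset.subset_univ _, Finset.singleton_biUnion⟩
  · intro C hC hne
    exfalso
    apply hne
    obtain ⟨-, hC⟩ := mem_coveringFamilies.mp hC
    have hmem : ∀ Z ∈ C, Z = cubeDom P M (k + 1) x := by
      intro Z hZ
      have hsub : Subtype.val Z ⊆ Subtype.val (cubeDom P M (k + 1) x) := by
        rw [← hC]
        exact Finset.subset_biUnion_of_mem (fun Z : (domSys P M (k + 1)).Dom => Subtype.val Z) hZ
      have h1 : ∀ y ∈ Subtype.val Z, y = x := fun y hy => by simpa [cubeDom] using hsub hy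
      have hx : x ∈ Subtype.val Z := by
        obtain ⟨y, hy⟩ := Z.2.1
        rwa [h1 y hy] at hy
      exact Subtype.ext (Finset.eq_singleton_iff_unique_mem.2 ⟨hx, h1⟩)
    have hne' : C.Nonempty := by
      rw [Finset.nonempty_iff_ne_empty]
      rintro rfl
      exact Finset.singleton_ne_empty x (hC.symm.trans Finset.biUnion_empty)
    obtain ⟨Z, hZ⟩ := hne'
    exact Finset.eq_singleton_iff_unique_mem.2 ⟨by rwa [hmem Z hZ] at hZ, hmem⟩

open Classical in
/-- **`E^{(k+1)}(□) = Log(1 + H(□))`**, the PRINCIPAL logarithm, when `‖H(□)‖ < 1` (`1 + H(□)` lies in the slit plane; the tree's `polymerLogZ_singleton`).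
[cite: Balaban1988RG2Cluster, (2.13) p.14; KoteckyPreiss1986, (2)-(3)] -/
theorem E_cubeDom_eq_log {k : ℕ} (S : ClusterStep P 𝔸 M k) (g : Fin (k + 1) → ℝ) (φ : CPair P 𝔸) (x : TPt P.d (domCount P M (k + 1)))
    (h : ‖S.H g φ (cubeDom P M (k + 1) x)‖ < 1) :
    S.E g φ (cubeDom P M (k + 1) x) = Complex.log (1 + S.H g φ (cubeDom P M (k + 1) x)) := by
  rw [E_cubeDom_eq_polymerLogZ]
  exact polymerLogZ_singleton (w := fun Z => S.H g φ Z) (Complex.mem_slitPlane_of_norm_lt_one h)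

open Classical in
/-- **`Re E^{(k+1)}(□) = log ‖1 + H(□)‖`** when `‖H(□)‖ < 1`. [cite: Balaban1988RG2Cluster, (2.13) p.14; KoteckyPreiss1986, (2)] -/
theorem re_E_cubeDom {k : ℕ} (S : ClusterStep P 𝔸 M k) (g : Fin (k + 1) → ℝ) (φ : CPair P 𝔸) (x : TPt P.d (domCount P M (k + 1)))
    (h : ‖S.H g φ (cubeDom P M (k + 1) x)‖ < 1) :
    (S.E g φ (cubeDom P M (k + 1) x)).re = Real.log ‖1 + S.H g φ (cubeDom P M (k + 1) x)‖ := by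
  rw [E_cubeDom_eq_log S g φ x h, Complex.log_re]

/-- **THE W1 FUNCTIONAL AT AN ATOM OF CREATION LEVEL `k+1`**: `functionalOn S p emb g U ⟨k+1, □⟩ = log ‖1 + H_k(□; g₀…g_k; emb U)‖` when `‖H_k(□)‖ < 1` — for ANY
tower, pairing, background and reading. [cite: Balaban1987RG1, (0.24) p.257 and §1 p.263; Balaban1988RG2Cluster, (2.13) p.14] -/
theorem functionalOn_cubeDom (S : ClusterTower P 𝔸 M) (p : RunPairing) {B : Type} (emb : B → CPair P 𝔸) (g : ℕ → ℝ) (U : B) (k : ℕ)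
    (x : TPt P.d (domCount P M (k + 1))) (h : ‖(S k).H (restrictPrefix k g) (emb U) (cubeDom P M (k + 1) x)‖ < 1) :
    functionalOn S p emb g U (⟨k + 1, cubeDom P M (k + 1) x⟩ : W1.Dom P M) =
      Real.log ‖1 + (S k).H (restrictPrefix k g) (emb U) (cubeDom P M (k + 1) x)‖ := by
  rw [← re_E_cubeDom (S k) (restrictPrefix k g) (emb U) x h]
  rfl

end Atom

/-! ## §2 At the phase tower: the functional reads the couplings -/

/-- `‖1 + c·e^{iθ}‖² = 1 + 2c·cos θ + c²` for real `c`, `θ`. [folklore] -/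
theorem normSq_one_add_real_mul_cexp (c θ : ℝ) :
    ‖(1 : ℂ) + (c : ℂ) * Complex.exp (Complex.I * (θ : ℂ))‖ ^ 2 = 1 + 2 * c * Real.cos θ + c ^ 2 := by
  rw [mul_comm Complex.I, Complex.sq_norm, Complex.normSq_apply]
  simp only [Complex.add_re, Complex.one_re, Complex.mul_re, Complex.ofReal_re, Complex.ofReal_im, Complex.exp_ofReal_mul_I_re,
    Complex.exp_ofReal_mul_I_im, zero_mul, sub_zero, Complex.add_im, Complex.one_im, Complex.mul_im, add_zero, zero_add]
  nlinarith [Real.sin_sq_add_cos_sq θ]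

section Tower
variable (F : T4Family) (K : ℕ) {𝔸 : Type*} {M : ℕ} (S : ClusterTower (F.P K) 𝔸 M) {A R ϱ ω : ℝ}
variable (hS : ∀ (k : ℕ) (g : Fin (k + 1) → ℝ) (φ : CPair (F.P K) 𝔸) (Z : (domSys (F.P K) M (k + 1)).Dom),
  (S k).H g φ Z = ((A * Real.exp (-2) * Real.exp (-(R * (domSys (F.P K) M (k + 1)).dj Z)) : ℝ) : ℂ) *
    Complex.exp (Complex.I * ((∑ i : Fin (k + 1), g i * (ω ^ (k + 1 - (i : ℕ)) / ϱ) : ℝ) : ℂ)))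
include hS

/-- **THE PHASE TOWER's FUNCTIONAL AT AN ATOM**: `functionalOn S p emb g U ⟨k+1, □⟩ = log ‖1 + A e^{−2}·e^{iθ_k(g)}‖`, `θ_k(g) = Σ_{i≤k} g_i ω^{k+1−i}∕ϱ`
(`d_{k+1}(□) = 0`; `0 ≤ A e^{−2} < 1`). [folklore] -/
theorem functionalOn_cubeDom_phaseTower (hA : 0 ≤ A) (hA1 : A * Real.exp (-2) < 1) (p : RunPairing) {B : Type} (emb : B → CPair (F.P K) 𝔸)
    (g : ℕ → ℝ) (U : B) (k : ℕ) (x : TPt (F.P K).d (domCount (F.P K) M (k + 1))) :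
    functionalOn S p emb g U (⟨k + 1, cubeDom (F.P K) M (k + 1) x⟩ : W1.Dom (F.P K) M) =
      Real.log ‖(1 : ℂ) + ((A * Real.exp (-2) : ℝ) : ℂ) *
        Complex.exp (Complex.I * ((∑ i : Fin (k + 1), g i * (ω ^ (k + 1 - (i : ℕ)) / ϱ) : ℝ) : ℂ))‖ := by
  have hH : (S k).H (restrictPrefix k g) (emb U) (cubeDom (F.P K) M (k + 1) x) =
      ((A * Real.exp (-2) : ℝ) : ℂ) * Complex.exp (Complex.I * ((∑ i : Fin (k + 1), g i * (ω ^ (k + 1 - (i : ℕ)) / ϱ) : ℝ) : ℂ)) := by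
    rw [hS, dj_cubeDom, mul_zero, neg_zero, Real.exp_zero, mul_one]
    rfl
  have hlt : ‖(S k).H (restrictPrefix k g) (emb U) (cubeDom (F.P K) M (k + 1) x)‖ < 1 := by
    rw [hH, norm_mul, norm_cexp_I_mul_ofReal, mul_one, Complex.norm_real, Real.norm_eq_abs, abs_of_nonneg (by positivity)]
    exact hA1
  rw [functionalOn_cubeDom S p emb g U k x hlt, hH]

/-- **★ THE W1 FUNCTIONAL OF THE PHASE TOWER READS THE COUPLINGS (functional-level A6).**  For `0 < A e^{−2} < 1`, `γ > 0`, `ϱ, ω > 0`, ANY pairing, background type,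
reading map, background `U` and cube `x` of `T^{(1)}`: two histories of the window `]0, γ]^ℕ` give DIFFERENT values of `W1.functionalOn S p emb` at the atom `⟨1, □ₓ⟩`
(histories `γ|g₀ := u∕f` and `γ|g₀ := u∕(2f)`, `f = ω∕ϱ`, `u = min(γf, π)`: `cos u < cos(u∕2)` on `]0, π]`, so `‖1 + A e^{−2}e^{iu}‖ < ‖1 + A e^{−2}e^{iu∕2}‖`).  Hence
`NE9 (functionalOn S p emb) (Window γ) …` at the phase tower (`ne9_and_fadingMemory_phaseTower`) bounds a difference that is NOT identically zero. [folklore] -/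
theorem exists_functionalOn_ne_phaseTower (hA : 0 < A) (hA1 : A * Real.exp (-2) < 1) {γ : ℝ} (hγ : 0 < γ) (hϱ : 0 < ϱ) (hω : 0 < ω) (p : RunPairing)
    {B : Type} (emb : B → CPair (F.P K) 𝔸) (U : B) (x : TPt (F.P K).d (domCount (F.P K) M 1)) :
    ∃ g ∈ Window γ, ∃ g' ∈ Window γ,
      functionalOn S p emb g U (⟨1, cubeDom (F.P K) M 1 x⟩ : W1.Dom (F.P K) M) ≠
        functionalOn S p emb g' U (⟨1, cubeDom (F.P K) M 1 x⟩ : W1.Dom (F.P K) M) := by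
  have hf : 0 < ω / ϱ := div_pos hω hϱ
  set u : ℝ := min (γ * (ω / ϱ)) Real.pi with hu_def
  have hu0 : 0 < u := lt_min (mul_pos hγ hf) Real.pi_pos
  have huπ : u ≤ Real.pi := min_le_right _ _
  have huγ : u / (ω / ϱ) ≤ γ := by rw [div_le_iff₀ hf]; exact min_le_left _ _
  have hc : 0 < A * Real.exp (-2) := by positivity
  -- the two histories
  refine ⟨Function.update (fun _ => γ) 0 (u / (ω / ϱ)), fun i => ?_, Function.update (fun _ => γ) 0 (u / (2 * (ω / ϱ))), fun i => ?_, ?_⟩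
  · by_cases hi : i = 0
    · subst hi; rw [Function.update_self]; exact ⟨div_pos hu0 hf, huγ⟩
    · rw [Function.update_of_ne hi]; exact ⟨hγ, le_rfl⟩
  · by_cases hi : i = 0
    · subst hi; rw [Function.update_self]
      refine ⟨by positivity, ?_⟩
      rw [div_le_iff₀ (by positivity)]
      nlinarith [min_le_left (γ * (ω / ϱ)) Real.pi]
    · rw [Function.update_of_ne hi]; exact ⟨hγ, le_rfl⟩
  -- the phases at level `0`
  have hθ : ∀ s : ℝ, (∑ i : Fin (0 + 1), Function.update (fun _ : ℕ => γ) 0 s i * (ω ^ (0 + 1 - (i : ℕ)) / ϱ)) = s * (ω / ϱ) := by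
    intro s
    rw [Fin.sum_univ_one]
    simp
  rw [functionalOn_cubeDom_phaseTower F K S hS hA.le hA1, functionalOn_cubeDom_phaseTower F K S hS hA.le hA1, hθ, hθ,
    show u / (ω / ϱ) * (ω / ϱ) = u by field_simp, show u / (2 * (ω / ϱ)) * (ω / ϱ) = u / 2 by field_simp]
  -- `cos u < cos (u/2)` ⇒ the norms differ ⇒ the logs differ
  have hcos : Real.cos u < Real.cos (u / 2) := Real.cos_lt_cos_of_nonneg_of_le_pi (by positivity) huπ (by linarith)
  have hsq : ‖(1 : ℂ) + ((A * Real.exp (-2) : ℝ) : ℂ) * Complex.exp (Complex.I * (u : ℂ))‖ ^ 2 <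
      ‖(1 : ℂ) + ((A * Real.exp (-2) : ℝ) : ℂ) * Complex.exp (Complex.I * ((u / 2 : ℝ) : ℂ))‖ ^ 2 := by
    rw [normSq_one_add_real_mul_cexp, normSq_one_add_real_mul_cexp]
    nlinarith
  have hlow : (1 - A * Real.exp (-2)) ^ 2 ≤ ‖(1 : ℂ) + ((A * Real.exp (-2) : ℝ) : ℂ) * Complex.exp (Complex.I * (u : ℂ))‖ ^ 2 := by
    rw [normSq_one_add_real_mul_cexp]
    nlinarith [Real.neg_one_le_cos u]
  have h1c : 0 < (1 - A * Real.exp (-2)) ^ 2 := by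
    have : 0 < 1 - A * Real.exp (-2) := by linarith
    positivity
  have ha : 0 < ‖(1 : ℂ) + ((A * Real.exp (-2) : ℝ) : ℂ) * Complex.exp (Complex.I * (u : ℂ))‖ := by
    nlinarith [norm_nonneg ((1 : ℂ) + ((A * Real.exp (-2) : ℝ) : ℂ) * Complex.exp (Complex.I * (u : ℂ)))]
  have hlt : ‖(1 : ℂ) + ((A * Real.exp (-2) : ℝ) : ℂ) * Complex.exp (Complex.I * (u : ℂ))‖ <
      ‖(1 : ℂ) + ((A * Real.exp (-2) : ℝ) : ℂ) * Complex.exp (Complex.I * ((u / 2 : ℝ) : ℂ))‖ := by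
    nlinarith [norm_nonneg ((1 : ℂ) + ((A * Real.exp (-2) : ℝ) : ℂ) * Complex.exp (Complex.I * (u : ℂ))),
      norm_nonneg ((1 : ℂ) + ((A * Real.exp (-2) : ℝ) : ℂ) * Complex.exp (Complex.I * ((u / 2 : ℝ) : ℂ)))]
  exact (Real.log_lt_log ha hlt).ne

end Tower

end YMDAG.N22.W1.CouplingRadii.PhaseTower

end
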